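import Mathlib
import Literature.Analysis.FluidPDE.AxisymmetricEuler
import Literature.Analysis.FluidPDE.AxisymmetricVorticityTransport
import Literature.Analysis.FluidPDE.LeiZhang2011StreamRescaling
import HarnessLib

/-!
# Census row A8t, line «pitch-defect»: tools for the helical Oseen gauge (stub S1)

Support file for the scenario census of `NavierStokesRegularity` (row A8t, line «pitch-defect»,
stub S1 `stub_helicalGauge`; KEY-NS #101 (2)). Elementary measure-theoretic and symmetry lemmas used
to transport the screw symmetry of a helical ancient solution through the tree's Oseen gauge
`u(t) = v(t, · − A(t)) + c(t)` (`Theorems.oseen_gauge_of_aestronglyMeasurable`):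

* `tendsto_setAverage_ball_sub_setAverage_ball` — **ball averages of a bounded field do not depend on
  the centre at infinity**: `⨍_{B(p,R)} g − ⨍_{B(0,R)} g → 0` as `R → ∞` (the symmetric difference
  of the two balls lies in the shell `B(0, R + ‖p‖) ∖ B(0, R − ‖p‖)`, of relative volume
  `((R+‖p‖)³ − (R−‖p‖)³)/R³ → 0`);
* `setAverage_ball_comp_rotZ_add` — `⨍_{B(0,R)} f(R_θ y + D) dy = ⨍_{B(D,R)} f` (rotations about the
  axis preserve Lebesgue measure and the balls about the origin);
* `twist_eq_of_forall` / `twist_eq_twist_of_tendsto` — if a bounded continuous field satisfies the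
  TWISTED screw identity `f(R_θ y + D) = R_θ f(y) + e` for all `y`, then `e` is read off from ball
  averages, `e = ⨍_{B(D,R)} f − R_θ ⨍_{B(0,R)} f`; hence two such fields `f`, `g` whose difference has
  vanishing ball averages at infinity (conservation of momentum) have the SAME twist constant `e`;
* `eq_smul_single_of_rotZ_pi_eq` — a vector fixed by the half turn about the axis is axial;
* `helical_transfer` — the screw symmetry of a slice `w` which is a.e. `x ↦ F(x − a) + c` with `F`
  continuous passes to `F` as the twisted identity with `D = R_θ a − a + hθ e₃`, `e = R_θ c − c`.

No Navier–Stokes input; no summit statement and no census row is proved here.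
-/

-- the summit and its single problem share the name (D-0017 nested layout)
set_option linter.dupNamespace false

noncomputable section

open MeasureTheory Set Function Filter Metric
open scoped Topology ENNReal NNReal

namespace Summit.NavierStokesRegularity.NavierStokesRegularity.Theorems.ScenarioCensus.PitchDefect

open Literature.Analysis Literature.Analysis.FluidPDE

/-! ### Ball averages of bounded fields: the centre does not matter at infinity -/

section Shift

variable {F : Type*} [NormedAddCommGroup F] [NormedSpace ℝ F]

/-- Volume of a ball of `ℝ³` about the origin: `|B(0,r)| = r³ |B(0,1)|` for `r ≥ 0`. [folklore] -/
theorem volumeReal_ball_zero {r : ℝ} (hr : 0 ≤ r) :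
    (volume : Measure (EuclideanSpace ℝ (Fin 3))).real (ball (0 : EuclideanSpace ℝ (Fin 3)) r) =
      r ^ 3 * (volume : Measure (EuclideanSpace ℝ (Fin 3))).real
        (ball (0 : EuclideanSpace ℝ (Fin 3)) 1) := by
  rw [measureReal_def, measureReal_def, Measure.addHaar_ball volume _ hr, finrank_euclideanSpace_fin,
    ENNReal.toReal_mul, ENNReal.toReal_ofReal (pow_nonneg hr _)]

omit [NormedSpace ℝ F] in
/-- A bounded a.e.-strongly measurable field is integrable on every ball. [folklore] -/
theorem integrableOn_ball_of_norm_le {g : EuclideanSpace ℝ (Fin 3) → F}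
    (hg : AEStronglyMeasurable g volume) {M : ℝ} (hM : ∀ x, ‖g x‖ ≤ M)
    (p : EuclideanSpace ℝ (Fin 3)) (R : ℝ) : IntegrableOn g (ball p R) volume :=
  Measure.integrableOn_of_bounded (M := M) measure_ball_lt_top.ne hg
    (Eventually.of_forall hM)

/-- **Ball averages of a bounded field do not depend on the centre at infinity**:
`⨍_{B(p,R)} g − ⨍_{B(0,R)} g → 0` as `R → ∞` for `g` bounded and a.e.-strongly measurable. The two
balls have the same volume `R³|B₁|`, and their symmetric difference lies in the shell
`B(0,R+‖p‖) ∖ B(0,R−‖p‖)` of volume `((R+‖p‖)³ − (R−‖p‖)³)|B₁|`, so the difference of the averages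
is at most `2M((R+‖p‖)³ − (R−‖p‖)³)/R³ = 2M(6‖p‖/R + 2‖p‖³/R³) → 0`. [folklore] -/
theorem tendsto_setAverage_ball_sub_setAverage_ball {g : EuclideanSpace ℝ (Fin 3) → F}
    (hg : AEStronglyMeasurable g volume) {M : ℝ} (hM : ∀ x, ‖g x‖ ≤ M)
    (p : EuclideanSpace ℝ (Fin 3)) :
    Tendsto (fun R : ℝ => (⨍ y in ball p R, g y) - ⨍ y in ball (0 : EuclideanSpace ℝ (Fin 3)) R, g y)
      atTop (𝓝 0) := by
  have ha0 : 0 ≤ ‖p‖ := norm_nonneg _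
  have hM0 : 0 ≤ M := (norm_nonneg _).trans (hM 0)
  have hB₁pos : 0 < (volume : Measure (EuclideanSpace ℝ (Fin 3))).real
      (ball (0 : EuclideanSpace ℝ (Fin 3)) 1) := by
    rw [measureReal_def]
    exact ENNReal.toReal_pos (measure_ball_pos volume _ one_pos).ne' measure_ball_lt_top.ne
  -- the bound for `R > ‖p‖`
  have hbound : ∀ R : ℝ, ‖p‖ < R →
      ‖(⨍ y in ball p R, g y) - ⨍ y in ball (0 : EuclideanSpace ℝ (Fin 3)) R, g y‖ ≤
        2 * M * (((R + ‖p‖) ^ 3 - (R - ‖p‖) ^ 3) / R ^ 3) := by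
    intro R hR
    have hR0 : 0 < R := lt_of_le_of_lt ha0 hR
    -- volumes
    have hvolB : (volume : Measure (EuclideanSpace ℝ (Fin 3))).real
        (ball (0 : EuclideanSpace ℝ (Fin 3)) R) =
        R ^ 3 * (volume : Measure (EuclideanSpace ℝ (Fin 3))).real
          (ball (0 : EuclideanSpace ℝ (Fin 3)) 1) := volumeReal_ball_zero hR0.le
    have hvolA : (volume : Measure (EuclideanSpace ℝ (Fin 3))).real (ball p R) =
        R ^ 3 * (volume : Measure (EuclideanSpace ℝ (Fin 3))).real
          (ball (0 : EuclideanSpace ℝ (Fin 3)) 1) := by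
      rw [Measure.addHaar_real_ball_center volume p R]; exact hvolB
    have hm0 : 0 < R ^ 3 * (volume : Measure (EuclideanSpace ℝ (Fin 3))).real
        (ball (0 : EuclideanSpace ℝ (Fin 3)) 1) := by positivity
    have hvolS : (volume : Measure (EuclideanSpace ℝ (Fin 3))).real
        (ball (0 : EuclideanSpace ℝ (Fin 3)) (R + ‖p‖) \ ball 0 (R - ‖p‖)) =
        ((R + ‖p‖) ^ 3 - (R - ‖p‖) ^ 3) *
          (volume : Measure (EuclideanSpace ℝ (Fin 3))).real (ball (0 : EuclideanSpace ℝ (Fin 3)) 1) := by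
      rw [measureReal_sdiff (ball_subset_ball (by linarith)) measurableSet_ball
        measure_ball_lt_top.ne, volumeReal_ball_zero (r := R + ‖p‖) (by linarith),
        volumeReal_ball_zero (r := R - ‖p‖) (by linarith)]
      ring
    -- the symmetric difference lies in the shell
    have hAB : ball p R \ ball (0 : EuclideanSpace ℝ (Fin 3)) R ⊆
        ball (0 : EuclideanSpace ℝ (Fin 3)) (R + ‖p‖) \ ball 0 (R - ‖p‖) := by
      intro y hy
      simp only [Set.mem_sdiff, mem_ball, dist_zero_right, not_lt] at hy ⊢
      refine ⟨?_, ?_⟩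
      · calc ‖y‖ = ‖(y - p) + p‖ := by rw [sub_add_cancel]
          _ ≤ ‖y - p‖ + ‖p‖ := norm_add_le _ _
          _ < R + ‖p‖ := by rw [← dist_eq_norm]; linarith [hy.1]
      · linarith [hy.2]
    have hBA : ball (0 : EuclideanSpace ℝ (Fin 3)) R \ ball p R ⊆
        ball (0 : EuclideanSpace ℝ (Fin 3)) (R + ‖p‖) \ ball 0 (R - ‖p‖) := by
      intro y hy
      simp only [Set.mem_sdiff, mem_ball, dist_zero_right, not_lt] at hy ⊢
      refine ⟨by linarith [hy.1], ?_⟩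
      have h1 : R ≤ dist y p := hy.2
      have h2 : dist y p ≤ ‖y‖ + ‖p‖ := by
        rw [dist_eq_norm]; exact norm_sub_le _ _
      linarith
    -- integrals over the pieces
    have hiA : IntegrableOn g (ball p R) volume := integrableOn_ball_of_norm_le hg hM p R
    have hiB : IntegrableOn g (ball (0 : EuclideanSpace ℝ (Fin 3)) R) volume :=
      integrableOn_ball_of_norm_le hg hM 0 R
    have hsplitA := integral_inter_add_sdiff (μ := volume) (f := g)
      (measurableSet_ball (x := (0 : EuclideanSpace ℝ (Fin 3))) (ε := R)) hiA
    have hsplitB := integral_inter_add_sdiff (μ := volume) (f := g)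
      (measurableSet_ball (x := p) (ε := R)) hiB
    have hinter : ball p R ∩ ball (0 : EuclideanSpace ℝ (Fin 3)) R = ball 0 R ∩ ball p R :=
      inter_comm _ _
    have hdiff : (∫ y in ball p R, g y) - ∫ y in ball (0 : EuclideanSpace ℝ (Fin 3)) R, g y =
        (∫ y in ball p R \ ball (0 : EuclideanSpace ℝ (Fin 3)) R, g y) -
          ∫ y in ball (0 : EuclideanSpace ℝ (Fin 3)) R \ ball p R, g y := by
      rw [← hsplitA, ← hsplitB, hinter]; abel
    have hSfin : volume (ball (0 : EuclideanSpace ℝ (Fin 3)) (R + ‖p‖) \ ball 0 (R - ‖p‖)) ≠ ∞ :=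
      measure_ne_top_of_subset sdiff_subset measure_ball_lt_top.ne
    have hnA : ‖∫ y in ball p R \ ball (0 : EuclideanSpace ℝ (Fin 3)) R, g y‖ ≤
        M * (volume : Measure (EuclideanSpace ℝ (Fin 3))).real
          (ball (0 : EuclideanSpace ℝ (Fin 3)) (R + ‖p‖) \ ball 0 (R - ‖p‖)) := by
      refine (norm_setIntegral_le_of_norm_le_const (lt_of_le_of_lt (measure_mono hAB)
        (lt_top_iff_ne_top.2 hSfin)) fun y _ => hM y).trans ?_
      exact mul_le_mul_of_nonneg_left (measureReal_mono hAB hSfin) hM0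
    have hnB : ‖∫ y in ball (0 : EuclideanSpace ℝ (Fin 3)) R \ ball p R, g y‖ ≤
        M * (volume : Measure (EuclideanSpace ℝ (Fin 3))).real
          (ball (0 : EuclideanSpace ℝ (Fin 3)) (R + ‖p‖) \ ball 0 (R - ‖p‖)) := by
      refine (norm_setIntegral_le_of_norm_le_const (lt_of_le_of_lt (measure_mono hBA)
        (lt_top_iff_ne_top.2 hSfin)) fun y _ => hM y).trans ?_
      exact mul_le_mul_of_nonneg_left (measureReal_mono hBA hSfin) hM0
    -- assemble
    rw [setAverage_eq, setAverage_eq, hvolA, hvolB, ← smul_sub, hdiff, norm_smul, norm_inv,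
      Real.norm_of_nonneg hm0.le]
    calc (R ^ 3 * (volume : Measure (EuclideanSpace ℝ (Fin 3))).real
          (ball (0 : EuclideanSpace ℝ (Fin 3)) 1))⁻¹ *
          ‖(∫ y in ball p R \ ball (0 : EuclideanSpace ℝ (Fin 3)) R, g y) -
            ∫ y in ball (0 : EuclideanSpace ℝ (Fin 3)) R \ ball p R, g y‖
        ≤ (R ^ 3 * (volume : Measure (EuclideanSpace ℝ (Fin 3))).real
            (ball (0 : EuclideanSpace ℝ (Fin 3)) 1))⁻¹ *
            (M * (volume : Measure (EuclideanSpace ℝ (Fin 3))).real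
              (ball (0 : EuclideanSpace ℝ (Fin 3)) (R + ‖p‖) \ ball 0 (R - ‖p‖)) +
             M * (volume : Measure (EuclideanSpace ℝ (Fin 3))).real
              (ball (0 : EuclideanSpace ℝ (Fin 3)) (R + ‖p‖) \ ball 0 (R - ‖p‖))) := by
          gcongr
          exact (norm_sub_le _ _).trans (add_le_add hnA hnB)
      _ = 2 * M * (((R + ‖p‖) ^ 3 - (R - ‖p‖) ^ 3) / R ^ 3) := by
          rw [hvolS]
          field_simp
          norm_num
  -- the bound tends to `0`
  have hlim : Tendsto (fun R : ℝ => 2 * M * (((R + ‖p‖) ^ 3 - (R - ‖p‖) ^ 3) / R ^ 3))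
      atTop (𝓝 0) := by
    have h1 : Tendsto (fun R : ℝ => R⁻¹) atTop (𝓝 0) := tendsto_inv_atTop_zero
    have h2 : Tendsto (fun R : ℝ => 2 * M * (6 * ‖p‖ * R⁻¹ + 2 * ‖p‖ ^ 3 * (R⁻¹ * R⁻¹ * R⁻¹)))
        atTop (𝓝 (2 * M * (6 * ‖p‖ * 0 + 2 * ‖p‖ ^ 3 * (0 * 0 * 0)))) :=
      ((h1.const_mul _).add (((h1.mul h1).mul h1).const_mul _)).const_mul _
    rw [mul_zero, zero_mul, zero_mul, mul_zero, add_zero, mul_zero] at h2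
    refine h2.congr' ?_
    filter_upwards [eventually_gt_atTop 0] with R hR
    have hR' : R ≠ 0 := hR.ne'
    field_simp
    ring
  refine squeeze_zero_norm' ?_ hlim
  filter_upwards [eventually_gt_atTop ‖p‖] with R hR
  exact hbound R hR

end Shift

/-! ### Rotations about the axis, balls and averages -/

/-- `R_θ` is continuous (it is the continuous linear map `rotZL θ`). [folklore] -/
theorem continuous_rotZ' (θ : ℝ) : Continuous (rotZ θ : EuclideanSpace ℝ (Fin 3) → _) :=
  (rotZL θ).continuous

/-- `R_θ` preserves the balls about the origin: `R_θ⁻¹ B(0,R) = B(0,R)`. [folklore] -/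
theorem preimage_rotZ_ball (θ R : ℝ) :
    (fun y : EuclideanSpace ℝ (Fin 3) => rotZ θ y) ⁻¹' ball 0 R = ball 0 R := by
  have h := (rotZLIE θ).preimage_ball 0 R
  rw [map_zero] at h
  exact h

/-- **Rotated and shifted ball averages**: `⨍_{B(0,R)} f(R_θ y + D) dy = ⨍_{B(D,R)} f`
(rotations about the axis preserve Lebesgue measure and `B(0,R)`; translations move the
centre). [folklore] -/
theorem setAverage_ball_comp_rotZ_add {F : Type*} [NormedAddCommGroup F] [NormedSpace ℝ F]
    [CompleteSpace F] (f : EuclideanSpace ℝ (Fin 3) → F) (θ : ℝ) (D : EuclideanSpace ℝ (Fin 3))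
    (R : ℝ) :
    ⨍ y in ball (0 : EuclideanSpace ℝ (Fin 3)) R, f (rotZ θ y + D) = ⨍ y in ball D R, f y := by
  have hmp : MeasurePreserving (fun y : EuclideanSpace ℝ (Fin 3) => rotZ θ y) volume volume :=
    (rotZLIE θ).measurePreserving
  have hme : MeasurableEmbedding (fun y : EuclideanSpace ℝ (Fin 3) => rotZ θ y) :=
    (rotZLIE θ).toHomeomorph.measurableEmbedding
  have h1 : ∫ y in ball (0 : EuclideanSpace ℝ (Fin 3)) R, f (rotZ θ y + D) =
      ∫ y in ball (0 : EuclideanSpace ℝ (Fin 3)) R, f (y + D) := by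
    have h := hmp.setIntegral_preimage_emb hme (fun z => f (z + D)) (ball 0 R)
    rw [preimage_rotZ_ball] at h
    exact h
  rw [setAverage_eq, setAverage_eq, h1, ← setAverage_eq, ← setAverage_eq,
    setAverage_ball_comp_add_right, zero_add]

/-- **Averages commute with the rotation**: `⨍_{B(0,R)} R_θ(f y) dy = R_θ ⨍_{B(0,R)} f` for `f`
integrable on the ball. [folklore] -/
theorem setAverage_ball_rotZ {f : EuclideanSpace ℝ (Fin 3) → EuclideanSpace ℝ (Fin 3)} {R : ℝ}
    (hf : IntegrableOn f (ball (0 : EuclideanSpace ℝ (Fin 3)) R) volume) (θ : ℝ) :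
    ⨍ y in ball (0 : EuclideanSpace ℝ (Fin 3)) R, rotZ θ (f y) =
      rotZ θ (⨍ y in ball (0 : EuclideanSpace ℝ (Fin 3)) R, f y) := by
  rw [setAverage_eq, setAverage_eq]
  have h : ∫ y in ball (0 : EuclideanSpace ℝ (Fin 3)) R, rotZ θ (f y) =
      rotZL θ (∫ y in ball (0 : EuclideanSpace ℝ (Fin 3)) R, f y) := by
    rw [← (rotZL θ).integral_comp_comm hf]
    rfl
  rw [h, ← rotZL_apply θ, map_smul]

/-- **The twist constant from ball averages.** If a bounded continuous field satisfies the twisted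
screw identity `f(R_θ y + D) = R_θ f(y) + e` for all `y`, then for every `R > 0`,
`e = ⨍_{B(D,R)} f − R_θ ⨍_{B(0,R)} f`. [folklore] -/
theorem twist_eq_of_forall {f : EuclideanSpace ℝ (Fin 3) → EuclideanSpace ℝ (Fin 3)}
    (hf : Continuous f) {M : ℝ} (hM : ∀ y, ‖f y‖ ≤ M) {θ : ℝ} {D e : EuclideanSpace ℝ (Fin 3)}
    (h : ∀ y, f (rotZ θ y + D) = rotZ θ (f y) + e) {R : ℝ} (hR : 0 < R) :
    e = (⨍ y in ball D R, f y) - rotZ θ (⨍ y in ball (0 : EuclideanSpace ℝ (Fin 3)) R, f y) := by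
  have hμ0 : volume (ball (0 : EuclideanSpace ℝ (Fin 3)) R) ≠ 0 := (measure_ball_pos volume _ hR).ne'
  have hμ : volume (ball (0 : EuclideanSpace ℝ (Fin 3)) R) ≠ ∞ := measure_ball_lt_top.ne
  have hfi : IntegrableOn f (ball (0 : EuclideanSpace ℝ (Fin 3)) R) volume :=
    integrableOn_ball_of_norm_le hf.aestronglyMeasurable hM 0 R
  have hri : IntegrableOn (fun y => rotZ θ (f y)) (ball (0 : EuclideanSpace ℝ (Fin 3)) R) volume :=
    integrableOn_ball_of_norm_le ((continuous_rotZ' θ).comp hf).aestronglyMeasurable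
      (M := M) (fun y => by simpa [norm_rotZ] using hM y) 0 R
  have h1 : (⨍ y in ball (0 : EuclideanSpace ℝ (Fin 3)) R, f (rotZ θ y + D)) =
      ⨍ y in ball (0 : EuclideanSpace ℝ (Fin 3)) R, (rotZ θ (f y) + e) :=
    setAverage_congr_fun measurableSet_ball (Eventually.of_forall fun y _ => h y)
  have h2 : (⨍ y in ball (0 : EuclideanSpace ℝ (Fin 3)) R, (rotZ θ (f y) + e)) =
      rotZ θ (⨍ y in ball (0 : EuclideanSpace ℝ (Fin 3)) R, f y) + e := by
    rw [setAverage_eq, integral_add hri (integrableOn_const hμ), smul_add, ← setAverage_eq,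
      ← setAverage_eq, setAverage_const hμ0 hμ, setAverage_ball_rotZ hfi]
  rw [setAverage_ball_comp_rotZ_add, h2] at h1
  rw [h1]; abel

/-- **Two twisted fields with the same momentum at infinity have the same twist constant.** If
`f(R_θ y + D) = R_θ f(y) + e` and `g(R_θ y + D') = R_θ g(y) + e'` for all `y` (bounded continuous
`f`, `g`) and `⨍_{B(0,R)} (f − g) → 0` as `R → ∞`, then `e = e'`: by `twist_eq_of_forall`,
`e − e' = [⨍_{B(D,R)} f − ⨍_{B(0,R)} f] + ⨍_{B(0,R)}(f − g) + [⨍_{B(0,R)} g − ⨍_{B(D',R)} g]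
− R_θ ⨍_{B(0,R)}(f − g)`, and every bracket tends to `0`
(`tendsto_setAverage_ball_sub_setAverage_ball`). [folklore] -/
theorem twist_eq_twist_of_tendsto {f g : EuclideanSpace ℝ (Fin 3) → EuclideanSpace ℝ (Fin 3)}
    (hf : Continuous f) (hg : Continuous g) {M : ℝ} (hfM : ∀ y, ‖f y‖ ≤ M) (hgM : ∀ y, ‖g y‖ ≤ M)
    {θ : ℝ} {D D' e e' : EuclideanSpace ℝ (Fin 3)}
    (hfe : ∀ y, f (rotZ θ y + D) = rotZ θ (f y) + e)
    (hge : ∀ y, g (rotZ θ y + D') = rotZ θ (g y) + e')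
    (hmom : Tendsto (fun R : ℝ => ⨍ y in ball (0 : EuclideanSpace ℝ (Fin 3)) R, (f y - g y))
      atTop (𝓝 0)) :
    e = e' := by
  -- the three vanishing brackets
  have T1 := tendsto_setAverage_ball_sub_setAverage_ball hf.aestronglyMeasurable hfM D
  have T3 := tendsto_setAverage_ball_sub_setAverage_ball hg.aestronglyMeasurable hgM D'
  have T4 : Tendsto (fun R : ℝ => rotZ θ (⨍ y in ball (0 : EuclideanSpace ℝ (Fin 3)) R, (f y - g y)))
      atTop (𝓝 0) := by
    have h := ((continuous_rotZ' θ).tendsto 0).comp hmom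
    have h0 : rotZ θ (0 : EuclideanSpace ℝ (Fin 3)) = 0 := by
      rw [← rotZL_apply, map_zero]
    rwa [h0] at h
  have hsum : Tendsto (fun R : ℝ =>
      ((⨍ y in ball D R, f y) - ⨍ y in ball (0 : EuclideanSpace ℝ (Fin 3)) R, f y) +
        (⨍ y in ball (0 : EuclideanSpace ℝ (Fin 3)) R, (f y - g y)) -
        ((⨍ y in ball D' R, g y) - ⨍ y in ball (0 : EuclideanSpace ℝ (Fin 3)) R, g y) -
        rotZ θ (⨍ y in ball (0 : EuclideanSpace ℝ (Fin 3)) R, (f y - g y))) atTop (𝓝 0) := by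
    have h := ((T1.add hmom).sub T3).sub T4
    simpa using h
  -- the sum is eventually the constant `e - e'`
  have hconst : ∀ᶠ R : ℝ in atTop,
      ((⨍ y in ball D R, f y) - ⨍ y in ball (0 : EuclideanSpace ℝ (Fin 3)) R, f y) +
        (⨍ y in ball (0 : EuclideanSpace ℝ (Fin 3)) R, (f y - g y)) -
        ((⨍ y in ball D' R, g y) - ⨍ y in ball (0 : EuclideanSpace ℝ (Fin 3)) R, g y) -
        rotZ θ (⨍ y in ball (0 : EuclideanSpace ℝ (Fin 3)) R, (f y - g y)) = e - e' := by
    filter_upwards [eventually_gt_atTop 0] with R hR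
    have hμ : volume (ball (0 : EuclideanSpace ℝ (Fin 3)) R) ≠ ∞ := measure_ball_lt_top.ne
    have hfi : IntegrableOn f (ball (0 : EuclideanSpace ℝ (Fin 3)) R) volume :=
      integrableOn_ball_of_norm_le hf.aestronglyMeasurable hfM 0 R
    have hgi : IntegrableOn g (ball (0 : EuclideanSpace ℝ (Fin 3)) R) volume :=
      integrableOn_ball_of_norm_le hg.aestronglyMeasurable hgM 0 R
    have hsub : (⨍ y in ball (0 : EuclideanSpace ℝ (Fin 3)) R, (f y - g y)) =
        (⨍ y in ball (0 : EuclideanSpace ℝ (Fin 3)) R, f y) -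
          ⨍ y in ball (0 : EuclideanSpace ℝ (Fin 3)) R, g y := by
      rw [setAverage_eq, setAverage_eq, setAverage_eq, integral_sub hfi hgi, smul_sub]
    rw [twist_eq_of_forall hf hfM hfe hR, twist_eq_of_forall hg hgM hge hR, hsub,
      ← rotZL_apply, ← rotZL_apply, ← rotZL_apply, map_sub]
    abel
  have hlim : Tendsto (fun _ : ℝ => e - e') atTop (𝓝 (0 : EuclideanSpace ℝ (Fin 3))) :=
    hsum.congr' hconst
  have h0 : e - e' = 0 := by
    have := tendsto_nhds_unique hlim tendsto_const_nhds
    first | exact this | exact this.symm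
  exact sub_eq_zero.1 h0

/-! ### Axial vectors and the transfer of the screw symmetry -/

/-- **A vector fixed by the half turn about the axis is axial**: `R_π d = d` forces
`d = d₃ e₃`. [folklore] -/
theorem eq_smul_single_of_rotZ_pi_eq {d : EuclideanSpace ℝ (Fin 3)} (h : rotZ Real.pi d = d) :
    d = (d 2) • EuclideanSpace.single (2 : Fin 3) (1 : ℝ) := by
  have h0 : d 0 = 0 := by
    have := congrArg (fun v : EuclideanSpace ℝ (Fin 3) => v 0) h
    simp only [rotZ_apply_zero, Real.cos_pi, Real.sin_pi] at this
    linarith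
  have h1 : d 1 = 0 := by
    have := congrArg (fun v : EuclideanSpace ℝ (Fin 3) => v 1) h
    simp only [rotZ_apply_one, Real.cos_pi, Real.sin_pi] at this
    linarith
  ext i
  fin_cases i <;> simp [h0, h1]

/-- An axial vector is fixed by every rotation about the axis. [folklore] -/
theorem rotZ_smul_single (θ a : ℝ) :
    rotZ θ (a • EuclideanSpace.single (2 : Fin 3) (1 : ℝ)) =
      a • EuclideanSpace.single (2 : Fin 3) (1 : ℝ) := by
  ext i
  fin_cases i <;> simp [rotZ]

/-- **Transfer of the screw symmetry through an a.e. representation.** If the slice `w` is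
helically symmetric (`w(R_θ x + hθ e₃) = R_θ w(x)` for all `x`) and agrees a.e. with
`x ↦ F(x − a) + c` for a continuous `F`, then `F` satisfies the twisted screw identity
`F(R_θ y + (R_θ a − a + hθ e₃)) = R_θ F(y) + (R_θ c − c)` for ALL `y` (compose the a.e.
identity with the measure-preserving screw motion, and compare two continuous functions which
agree a.e.). [folklore] -/
theorem helical_transfer {w F : EuclideanSpace ℝ (Fin 3) → EuclideanSpace ℝ (Fin 3)}
    {h θ : ℝ} {a c : EuclideanSpace ℝ (Fin 3)} (hF : Continuous F)
    (hhel : ∀ x, w (rotZ θ x + (h * θ) • EuclideanSpace.single (2 : Fin 3) (1 : ℝ)) = rotZ θ (w x))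
    (hrep : w =ᵐ[volume] fun x => F (x - a) + c) :
    ∀ y, F (rotZ θ y + (rotZ θ a - a + (h * θ) • EuclideanSpace.single (2 : Fin 3) (1 : ℝ))) =
      rotZ θ (F y) + (rotZ θ c - c) := by
  set S : EuclideanSpace ℝ (Fin 3) → EuclideanSpace ℝ (Fin 3) :=
    fun x => rotZ θ x + (h * θ) • EuclideanSpace.single (2 : Fin 3) (1 : ℝ) with hS
  have hmp : MeasurePreserving S volume volume :=
    (measurePreserving_add_right (volume : Measure (EuclideanSpace ℝ (Fin 3)))
      ((h * θ) • EuclideanSpace.single (2 : Fin 3) (1 : ℝ))).comp (rotZLIE θ).measurePreserving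
  -- `w ∘ S = (F(· - a) + c) ∘ S` a.e.
  have h1 : (fun x => w (S x)) =ᵐ[volume] fun x => F (S x - a) + c :=
    hmp.quasiMeasurePreserving.ae_eq_comp hrep
  -- `R_θ ∘ w = R_θ ∘ (F(· - a) + c)` a.e.
  have h2 : (fun x => rotZ θ (w x)) =ᵐ[volume] fun x => rotZ θ (F (x - a) + c) := by
    filter_upwards [hrep] with x hx
    rw [hx]
  have h3 : (fun x => F (S x - a) + c) =ᵐ[volume] fun x => rotZ θ (F (x - a) + c) := by
    filter_upwards [h1, h2] with x hx1 hx2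
    have hSx : w (S x) = rotZ θ (w x) := hhel x
    rw [← hx1, hSx, hx2]
  -- both sides are continuous, hence equal everywhere
  have hSc : Continuous S := ((continuous_rotZ' θ).add continuous_const)
  have hl : Continuous fun x => F (S x - a) + c := (hF.comp (hSc.sub continuous_const)).add
    continuous_const
  have hr : Continuous fun x => rotZ θ (F (x - a) + c) :=
    (continuous_rotZ' θ).comp ((hF.comp (continuous_id.sub continuous_const)).add continuous_const)
  have heq := (Continuous.ae_eq_iff_eq volume hl hr).1 h3
  intro y
  have hy := congrFun heq (y + a)
  simp only [hS, add_sub_cancel_right] at hy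
  -- `S (y + a) - a = R_θ y + (R_θ a - a + hθ e₃)`
  have e1 : rotZ θ (y + a) + (h * θ) • EuclideanSpace.single (2 : Fin 3) (1 : ℝ) - a =
      rotZ θ y + (rotZ θ a - a + (h * θ) • EuclideanSpace.single (2 : Fin 3) (1 : ℝ)) := by
    rw [← rotZL_apply, map_add, rotZL_apply, rotZL_apply]; abel
  have e2 : rotZ θ (F y + c) = rotZ θ (F y) + rotZ θ c := by
    rw [← rotZL_apply, map_add, rotZL_apply, rotZL_apply]
  rw [e1, e2] at hy
  rw [eq_sub_of_add_eq hy]; abel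

end Summit.NavierStokesRegularity.NavierStokesRegularity.Theorems.ScenarioCensus.PitchDefect

end
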